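import Summits.AtomisticToContinuum.BoseEinsteinCondensation.Theorems.BECGroundStateSOSPeriodicIRBoundTwoSectorPairDefs
import Summits.AtomisticToContinuum.BoseEinsteinCondensation.Theorems.BECGroundStateSOSIRModeCounting
import HarnessLib

/-!
# Route `BECGroundStateSOS`, crux `PeriodicIRBound` (stmt-AtomisticToContinuum-3972), line `two-sector-gd-transfer`
# (v11 "pointwise floating + soft location") — stub S11c `stub_condensateFractionOfIR : CondensateFractionOfIR`

Supports (does not close) stmt-AtomisticToContinuum-3972. The registered stub S11c of the v11 skeleton (statement
`CondensateFractionOfIR` in `Theorems/BECGroundStateSOSPeriodicIRBoundTwoSectorPairDefs.lean` §2; SOFT-LOCATION.md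
Step 4): for ONE admissible potential `v`, the crux's infrared inequality `IRBoundFor v` (`n_k(Ψ) ≤ C√ρL_N/‖k‖_∞` on the
window `0 < ‖k‖_∞ ≤ κ√ρL_N` for near-minimisers, every `κ`, small `ρ`, eventually in `N`) gives `ρ₀ > 0` such that for
`ρ < ρ₀`, eventually in `N`, some slack `δ_N > 0` makes every `δ_N`-near-minimiser on the torus of side
`L_N = (N/ρ)^{1/3}` have zero-mode occupation `n_0 = ⟨φ_0, γ_Ψ φ_0⟩ ≥ 7N/8`.

Proof: the landed route item `IRModeCounting_proof` (`Theorems/BECGroundStateSOSIRModeCounting.lean`) run for one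
potential with margins `N/16` in place of `N/4`. Parseval in the traced variable `∑_k n_k = N` and for the gradient
`∑_k |2πk/L|² n_k ≤ ⟨Ψ,HΨ⟩` (`PeriodicBoseGasFracEnergy`); the LSSY upper bound `E₀^per ≤ AρN`, `A = 4πa(1 + C₁c₁)`
(`LSSY2005_upperBound_periodic_holds`); with `π²κ² = 4(A+1)` and slack `δ ≤ ρN` the ultraviolet tail `‖k‖_∞ > κ√ρL`
carries `≤ (A+1)ρN/(4π²κ²ρ) = N/16` particles; the shell sum `∑_{0<‖k‖_∞≤M} 1/‖k‖_∞ ≤ 26M²`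
(`ModeCounting.sum_inv_norm_latticeShell_le_sq`) bounds the infrared window by `26Cκ²√ρ·N ≤ N/16` once
`√ρ ≤ 1/(416Cκ²)`; hence `n_0 ≥ N − N/16 − N/16 = 7N/8` (`CondensateFraction.condensate_ge_of_margins`, the counting
step in abstract form). Mode counting after LSSY2005 §1.2 (1.17)–(1.19); nothing is cited as a new fact.
-/

noncomputable section

open scoped BigOperators ENNReal NNReal
open Filter MeasureTheory

namespace Summit.AtomisticToContinuum.BoseEinsteinCondensation.Cruxes.PeriodicIRBound.TwoSectorGdTransfer

open Literature.MathematicalPhysics.QuantumManyBody.BoseGas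
open Summit.AtomisticToContinuum.BoseEinsteinCondensation.Theorems.PeriodicIRBound.Negative
  (IRBoundFor NearMin InWindow IRIneq irIneq_iff)
open Summit.AtomisticToContinuum.BoseEinsteinCondensation.Theorems.ModeCounting
  (mem_latticeBox_floor_of_norm_le sum_inv_norm_latticeShell_le_sq norm_sq_le_sum_sq)

namespace CondensateFraction

/-- **Mode counting on the torus with margins `N/16` (abstract form).** Let `Ψ` be a periodic `N`-body state on the
torus of side `L`, `n_k = ⟨φ_k, γ_Ψ φ_k⟩` its plane-wave occupations. Suppose (IR) `n_k ≤ C_ir/‖k‖_∞` for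
`0 < ‖k‖_∞ ≤ K`; (UV) `D ≤ |2πk/L|²` for `‖k‖_∞ > K`, with `D⁻¹⟨Ψ,HΨ⟩ ≤ N/16`; (window) `26 C_ir K² ≤ N/16`. Then
`n_0 ≥ 7N/8`, since by Parseval
`N = ∑_k n_k ≤ n₀ + ∑_{IR} C_ir/‖k‖_∞ + D⁻¹∑_k|2πk/L|²n_k ≤ n₀ + 26 C_ir K² + D⁻¹⟨Ψ,HΨ⟩` (the proof of
`ModeCounting.condensate_ge_half` with the final arithmetic changed). [cite: LSSY2005, §1.2 (1.17)–(1.19)] -/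
theorem condensate_ge_of_margins {N : ℕ} {L K Cir : ℝ} (hL : 0 < L) (hK : 0 ≤ K) (hCir : 0 ≤ Cir)
    (v : ℝ → ℝ≥0∞) (Ψ : PeriodicTrialState N L) {D : ℝ≥0∞} (hD0 : D ≠ 0) (hDtop : D ≠ ⊤)
    (hIR : ∀ k : Fin 3 → ℤ, k ≠ 0 → ‖(fun i => (k i : ℝ))‖ ≤ K →
      cellOccupation N L (planeWaveMode L k) Ψ.ψ ≤ ENNReal.ofReal (Cir / ‖(fun i => (k i : ℝ))‖))
    (hUV : ∀ k : Fin 3 → ℤ, K < ‖(fun i => (k i : ℝ))‖ → D ≤ fracDispersion 2 L k)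
    (hT : D⁻¹ * periodicEnergy v Ψ ≤ ENNReal.ofReal (N / 16))
    (hW : Cir * (26 * K ^ 2) ≤ N / 16) :
    ENNReal.ofReal (7 / 8 * (N : ℝ)) ≤ cellOccupation N L (planeWaveMode L 0) Ψ.ψ := by
  classical
  set n : (Fin 3 → ℤ) → ℝ≥0∞ := fun k => cellOccupation N L (planeWaveMode L k) Ψ.ψ with hn
  set M : ℕ := ⌊K⌋₊ with hM
  set S : Finset (Fin 3 → ℤ) := (Fintype.piFinset fun _ : Fin 3 => Finset.Icc (-(M : ℤ)) (M : ℤ)).erase 0 with hS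
  -- pointwise three-way bound: zero mode / infrared window / ultraviolet tail
  have hpt : ∀ k, n k ≤ (if k = 0 then n k else 0) +
      (if k ∈ S then ENNReal.ofReal (Cir / ‖(fun i => (k i : ℝ))‖) else 0) + D⁻¹ * (fracDispersion 2 L k * n k) := by
    intro k
    by_cases hk0 : k = 0
    · rw [if_pos hk0]
      exact le_add_right (le_add_right le_rfl)
    · by_cases hkK : ‖(fun i => (k i : ℝ))‖ ≤ K
      · have hkS : k ∈ S := Finset.mem_erase.2 ⟨hk0, mem_latticeBox_floor_of_norm_le hkK⟩
        rw [if_neg hk0, if_pos hkS, zero_add]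
        exact le_add_right (hIR k hk0 hkK)
      · push Not at hkK
        refine le_add_left ?_
        calc n k = D⁻¹ * D * n k := by rw [ENNReal.inv_mul_cancel hD0 hDtop, one_mul]
          _ ≤ D⁻¹ * fracDispersion 2 L k * n k := by gcongr; exact hUV k hkK
          _ = D⁻¹ * (fracDispersion 2 L k * n k) := mul_assoc _ _ _
  -- the infrared window carries at most `N/16`
  have hIRsum : ∑ k ∈ S, ENNReal.ofReal (Cir / ‖(fun i => (k i : ℝ))‖) ≤ ENNReal.ofReal (N / 16) := by
    rw [← ENNReal.ofReal_sum_of_nonneg (fun k _ => by positivity)]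
    refine ENNReal.ofReal_le_ofReal ?_
    calc ∑ k ∈ S, Cir / ‖(fun i => (k i : ℝ))‖ = Cir * ∑ k ∈ S, 1 / ‖(fun i => (k i : ℝ))‖ := by
          rw [Finset.mul_sum]
          exact Finset.sum_congr rfl fun k _ => (mul_one_div _ _).symm
      _ ≤ Cir * (26 * (M : ℝ) ^ 2) := by gcongr; exact sum_inv_norm_latticeShell_le_sq M
      _ ≤ Cir * (26 * K ^ 2) := by gcongr; exact Nat.floor_le hK
      _ ≤ N / 16 := hW
  -- the ultraviolet tail carries at most `N/16`
  have hTsum : D⁻¹ * ∑' k, fracDispersion 2 L k * n k ≤ ENNReal.ofReal (N / 16) := by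
    refine le_trans ?_ hT
    gcongr
    calc ∑' k, fracDispersion 2 L k * n k = ∫⁻ X in cellN N L, kineticDensity Ψ.ψ X :=
          tsum_fracDispersion_two_mul_cellOccupation hL Ψ
      _ ≤ periodicEnergy v Ψ := lintegral_mono fun X => le_self_add
  -- Parseval and summation of the pointwise bound
  have hS' : ∑ k ∈ S, (if k ∈ S then ENNReal.ofReal (Cir / ‖(fun i => (k i : ℝ))‖) else 0) =
      ∑ k ∈ S, ENNReal.ofReal (Cir / ‖(fun i => (k i : ℝ))‖) :=
    Finset.sum_congr rfl fun k hk => if_pos hk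
  have hsum : (N : ℝ≥0∞) ≤ n 0 + ENNReal.ofReal (N / 16) + ENNReal.ofReal (N / 16) := by
    calc (N : ℝ≥0∞) = ∑' k, n k := (Ψ.tsum_cellOccupation_planeWaveMode hL).symm
      _ ≤ ∑' k, ((if k = 0 then n k else 0) + (if k ∈ S then ENNReal.ofReal (Cir / ‖(fun i => (k i : ℝ))‖) else 0)
          + D⁻¹ * (fracDispersion 2 L k * n k)) := ENNReal.tsum_le_tsum hpt
      _ = n 0 + ∑ k ∈ S, ENNReal.ofReal (Cir / ‖(fun i => (k i : ℝ))‖) +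
          D⁻¹ * ∑' k, fracDispersion 2 L k * n k := by
          rw [ENNReal.tsum_add, ENNReal.tsum_add, tsum_ite_eq 0 n, ENNReal.tsum_mul_left,
            tsum_eq_sum (s := S) fun k hk => if_neg hk, hS']
      _ ≤ n 0 + ENNReal.ofReal (N / 16) + ENNReal.ofReal (N / 16) := by gcongr
  -- conclusion: `7N/8 + N/8 ≤ n₀ + N/8`
  have h2 : ENNReal.ofReal (7 / 8 * (N : ℝ)) + ENNReal.ofReal (1 / 8 * (N : ℝ)) = (N : ℝ≥0∞) := by
    rw [← ENNReal.ofReal_add (by positivity) (by positivity), ← ENNReal.ofReal_natCast]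
    exact congrArg ENNReal.ofReal (by ring)
  have h4 : ENNReal.ofReal ((N : ℝ) / 16) + ENNReal.ofReal ((N : ℝ) / 16) =
      ENNReal.ofReal (1 / 8 * (N : ℝ)) := by
    rw [← ENNReal.ofReal_add (by positivity) (by positivity)]
    exact congrArg ENNReal.ofReal (by ring)
  have hfin : ENNReal.ofReal (7 / 8 * (N : ℝ)) + ENNReal.ofReal (1 / 8 * (N : ℝ)) ≤
      n 0 + ENNReal.ofReal (1 / 8 * (N : ℝ)) := by
    rw [h2, ← h4, ← add_assoc]
    exact hsum
  exact ENNReal.le_of_add_le_add_right ENNReal.ofReal_ne_top hfin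

end CondensateFraction

/-- **Stub S11c — condensate fraction `7/8` from the infrared bound, per potential** (SOFT-LOCATION.md Step 4): for an
admissible `v`, `IRBoundFor v` gives `ρ₀ > 0` such that for `ρ < ρ₀`, eventually in `N`, some slack `δ_N > 0` makes
every `δ_N`-near-minimiser on the torus of side `L_N = (N/ρ)^{1/3}` have `n_0 ≥ 7N/8`. Constants: `κ = 2√(A+1)/π`
(`π²κ² = 4(A+1)`, `A = 4πa(1 + C₁c₁)` from LSSY Thm. 2.2, UV tail `≤ N/16` by the kinetic Markov bound with slack
`δ_N ≤ ρN`), `√ρ < 1/(416Cκ²)` (IR window `≤ N/16` by the shell sum), `ρ` below the threshold `ρ_X(κ)` of `IRBoundFor v`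
and below the LSSY threshold `(a+1)(4πρ/3)^{1/3} < c₁`; `δ_N = min(δ_X, ρN)`.
[cite: LSSY2005, Thm. 2.2 (2.14) and §1.2 (1.17)–(1.19)] -/
theorem stub_condensateFractionOfIR : CondensateFractionOfIR := by
  intro v hv hIR
  -- constants attached to `v`: range, scattering length, the LSSY upper bound
  obtain ⟨R, hR, hvR⟩ := hv.exists_pos_range
  obtain ⟨C₁, c₁, hC₁, hc₁, hLSSY⟩ :=
    LSSY2005_upperBound_periodic_holds v R hv.1 hvR hv.scatteringLength_ne_top
  set a : ℝ := (scatteringLength v).toReal with ha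
  have ha0 : 0 ≤ a := ENNReal.toReal_nonneg
  set A : ℝ := 4 * Real.pi * a * (1 + C₁ * c₁) with hA
  have hA0 : 0 ≤ A := by positivity
  set κ : ℝ := 2 * Real.sqrt (A + 1) / Real.pi with hκ
  have hκ0 : 0 < κ := by positivity
  have hκ2 : Real.pi ^ 2 * κ ^ 2 = 4 * (A + 1) := by
    rw [hκ, div_pow, mul_pow, Real.sq_sqrt (by positivity)]
    field_simp
    ring
  obtain ⟨ρX, hρX, C, hC, hXv⟩ := hIR κ hκ0
  -- density thresholds
  set ρa : ℝ := 3 * (c₁ / (a + 1)) ^ 3 / (4 * Real.pi) with hρa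
  have hρa0 : 0 < ρa := by positivity
  set ρC : ℝ := (1 / (416 * C * κ ^ 2)) ^ 2 with hρC
  have hρC0 : 0 < ρC := by positivity
  refine ⟨min ρX (min ρa ρC), lt_min hρX (lt_min hρa0 hρC0), fun ρ hρ hρ₀ => ?_⟩
  have hρX' : ρ < ρX := lt_of_lt_of_le hρ₀ (min_le_left _ _)
  have hρa' : ρ < ρa := lt_of_lt_of_le hρ₀ ((min_le_right _ _).trans (min_le_left _ _))
  have hρC' : ρ < ρC := lt_of_lt_of_le hρ₀ ((min_le_right _ _).trans (min_le_right _ _))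
  -- consequences of the thresholds
  have hsmall : (a + 1) * (4 * Real.pi * ρ / 3) ^ ((1 : ℝ) / 3) < c₁ := by
    have h1 : 4 * Real.pi * ρ / 3 < (c₁ / (a + 1)) ^ 3 := by
      rw [hρa, lt_div_iff₀ (by positivity)] at hρa'
      rw [div_lt_iff₀ (by norm_num : (0 : ℝ) < 3)]
      linarith
    have h2 : (4 * Real.pi * ρ / 3) ^ ((1 : ℝ) / 3) < c₁ / (a + 1) := by
      calc (4 * Real.pi * ρ / 3) ^ ((1 : ℝ) / 3) < ((c₁ / (a + 1)) ^ 3) ^ ((1 : ℝ) / 3) :=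
            Real.rpow_lt_rpow (by positivity) h1 (by norm_num)
        _ = c₁ / (a + 1) := by
            rw [show ((1 : ℝ) / 3) = ((3 : ℕ) : ℝ)⁻¹ by norm_num,
              Real.pow_rpow_inv_natCast (by positivity) (by norm_num)]
    calc (a + 1) * (4 * Real.pi * ρ / 3) ^ ((1 : ℝ) / 3) < (a + 1) * (c₁ / (a + 1)) := by
          gcongr
      _ = c₁ := by field_simp
  have hsqrtρ : 416 * C * κ ^ 2 * Real.sqrt ρ ≤ 1 := by
    have h1 : Real.sqrt ρ < 1 / (416 * C * κ ^ 2) := by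
      calc Real.sqrt ρ < Real.sqrt ρC := Real.sqrt_lt_sqrt hρ.le hρC'
        _ = 1 / (416 * C * κ ^ 2) := by rw [hρC, Real.sqrt_sq (by positivity)]
    rw [lt_div_iff₀ (by positivity)] at h1
    linarith
  -- eventually in `N`: the slack of `IRBoundFor v`, `N ≥ 2`, `2R < L_N`
  filter_upwards [hXv ρ hρ hρX', eventually_ge_atTop 2,
    (tendsto_sideLength_atTop hρ).eventually_gt_atTop (2 * R)] with N ⟨δX, hδX, hXN⟩ hN2 hRL
  have hN : 0 < N := lt_of_lt_of_le two_pos hN2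
  have hNr : (0 : ℝ) < N := Nat.cast_pos.2 hN
  set L : ℝ := sideLength ρ N with hLdef
  have hL : 0 < L := Real.rpow_pos_of_pos (div_pos hNr hρ) _
  have hL3 : ρ * L ^ 3 = N := by
    rw [hLdef, sideLength_pow_three hρ N]
    field_simp
  -- the energy bound `E₀^per ≤ A ρ N` (LSSY Thm. 2.2 with `ρ₁ ≤ ρ`, `a/b ≤ c₁`)
  have hE0 : periodicGroundStateEnergy v N L ≤ ENNReal.ofReal (A * ρ * N) := by
    have hL1 := hLSSY N L hN2 hL hRL
    simp only [] at hL1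
    set ρ₁ : ℝ := ((N : ℝ) - 1) / L ^ 3 with hρ₁
    have hN2r : (2 : ℝ) ≤ N := by exact_mod_cast hN2
    have hρ₁0 : 0 ≤ ρ₁ := div_nonneg (by linarith) (by positivity)
    have hρ₁ρ : ρ₁ ≤ ρ := by
      rw [hρ₁, div_le_iff₀ (by positivity), hL3]
      linarith
    have hx : a * (4 * Real.pi * ρ₁ / 3) ^ ((1 : ℝ) / 3) ≤ c₁ := by
      have h1 : (4 * Real.pi * ρ₁ / 3) ^ ((1 : ℝ) / 3) ≤ (4 * Real.pi * ρ / 3) ^ ((1 : ℝ) / 3) :=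
        Real.rpow_le_rpow (by positivity) (by gcongr) (by norm_num)
      calc a * (4 * Real.pi * ρ₁ / 3) ^ ((1 : ℝ) / 3)
          ≤ (a + 1) * (4 * Real.pi * ρ / 3) ^ ((1 : ℝ) / 3) :=
            mul_le_mul (by linarith) h1 (by positivity) (by positivity)
        _ ≤ c₁ := hsmall.le
    have hL2 := hL1 (by rw [div_rpow_neg_third (by positivity)]; exact hx)
    rw [div_rpow_neg_third (by positivity)] at hL2
    refine hL2.trans (ENNReal.ofReal_le_ofReal ?_)
    rw [hA]
    calc 4 * Real.pi * ρ₁ * a * (1 + C₁ * (a * (4 * Real.pi * ρ₁ / 3) ^ ((1 : ℝ) / 3))) * N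
        ≤ 4 * Real.pi * ρ * a * (1 + C₁ * c₁) * N := by gcongr
      _ = 4 * Real.pi * a * (1 + C₁ * c₁) * ρ * N := by ring
  -- the slack `δ_N = min(δ_X, ρN)`
  refine ⟨min δX (ENNReal.ofReal (ρ * N)), lt_min hδX (ENNReal.ofReal_pos.2 (by positivity)), ?_⟩
  intro Ψ hΨ
  have hΨX : NearMin v ρ N δX Ψ := hΨ.trans (add_le_add le_rfl (min_le_left _ _))
  have hΨE : periodicEnergy v Ψ ≤ ENNReal.ofReal ((A + 1) * ρ * N) := by
    calc periodicEnergy v Ψ ≤ periodicGroundStateEnergy v N L + ENNReal.ofReal (ρ * N) :=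
          hΨ.trans (add_le_add le_rfl (min_le_right _ _))
      _ ≤ ENNReal.ofReal (A * ρ * N) + ENNReal.ofReal (ρ * N) := add_le_add hE0 le_rfl
      _ = ENNReal.ofReal ((A + 1) * ρ * N) := by
          rw [← ENNReal.ofReal_add (by positivity) (by positivity)]
          exact congrArg ENNReal.ofReal (by ring)
  -- the counting step with `K = κ√ρL`, `C_ir = C√ρL`, `D = 4π²κ²ρ`
  set D : ℝ≥0∞ := ENNReal.ofReal (4 * Real.pi ^ 2 * κ ^ 2 * ρ) with hD
  have hDpos : 0 < 4 * Real.pi ^ 2 * κ ^ 2 * ρ := by positivity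
  have hD0 : D ≠ 0 := (ENNReal.ofReal_pos.2 hDpos).ne'
  refine CondensateFraction.condensate_ge_of_margins hL (K := κ * Real.sqrt ρ * L)
    (Cir := C * Real.sqrt ρ * L) (by positivity) (by positivity) v Ψ hD0 ENNReal.ofReal_ne_top
    ?_ ?_ ?_ ?_
  · -- (IR) the hypothesis `IRBoundFor v` at `κ`, slack `δ_X`
    intro k hk0 hkK
    have h := hXN Ψ hΨX k ⟨hk0, hkK⟩
    rwa [irIneq_iff] at h
  · -- (UV) `4π²κ²ρ ≤ |2πk/L|²` off the window (`‖k‖_∞² ≤ |k|₂²`)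
    intro k hk
    rw [hD, fracDispersion_two]
    refine ENNReal.ofReal_le_ofReal ?_
    have h1 : (κ * Real.sqrt ρ * L) ^ 2 < ∑ j, (k j : ℝ) ^ 2 := by
      calc (κ * Real.sqrt ρ * L) ^ 2 < ‖(fun i => (k i : ℝ))‖ ^ 2 := by gcongr
        _ ≤ ∑ j, (k j : ℝ) ^ 2 := norm_sq_le_sum_sq k
    rw [mul_pow, mul_pow, Real.sq_sqrt hρ.le] at h1
    rw [le_div_iff₀ (by positivity)]
    calc 4 * Real.pi ^ 2 * κ ^ 2 * ρ * L ^ 2 = 4 * Real.pi ^ 2 * (κ ^ 2 * ρ * L ^ 2) := by ring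
      _ ≤ 4 * Real.pi ^ 2 * ∑ j, (k j : ℝ) ^ 2 := by gcongr
  · -- (T) `(E₀ + δ)/(4π²κ²ρ) ≤ (A+1)ρN/(16(A+1)ρ) = N/16`
    calc D⁻¹ * periodicEnergy v Ψ ≤ D⁻¹ * ENNReal.ofReal ((A + 1) * ρ * N) := by gcongr
      _ = ENNReal.ofReal ((A + 1) * ρ * N / (4 * Real.pi ^ 2 * κ ^ 2 * ρ)) := by
          rw [← ENNReal.div_eq_inv_mul, hD, ← ENNReal.ofReal_div_of_pos hDpos]
      _ = ENNReal.ofReal (N / 16) := by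
          congr 1
          rw [show 4 * Real.pi ^ 2 * κ ^ 2 * ρ = 4 * (Real.pi ^ 2 * κ ^ 2) * ρ by ring, hκ2]
          field_simp
          ring
  · -- (window) `C√ρL · 26 κ²ρL² = 26Cκ²√ρ·N ≤ N/16`
    have h1 : C * Real.sqrt ρ * L * (26 * (κ * Real.sqrt ρ * L) ^ 2) =
        26 * C * κ ^ 2 * Real.sqrt ρ * (ρ * L ^ 3) := by
      rw [mul_pow, mul_pow, Real.sq_sqrt hρ.le]
      ring
    rw [h1, hL3]
    nlinarith [hsqrtρ, hNr.le]

end Summit.AtomisticToContinuum.BoseEinsteinCondensation.Cruxes.PeriodicIRBound.TwoSectorGdTransfer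

end
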